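import Summits.PneNP.PneNP.Theorems.OracleRefusal.Negative.StaInvSlots

/-!
# `OracleRefusal` (stmt-PneNP-1864) — negative side, II: Semantic inversion, part 2: the runs of a VARIABLE through any administrative rules (§B.3: one wrapped leaf, junk
elsewhere), and the TYPE side (§B.4): bang counts of head arrows survive `(∀I)/(∀E)` (`ArrLike`, `BoolLike`), and the
quantifier tower `∀ʲ K⁺ʲ` of a variable of non-quantified kernel `K` (`var_ty`).
-/

namespace Summit.PneNP.PneNP.Theorems.OracleRefusal.Negative

open Literature.Computability.ImplicitComplexity
open Literature.Computability.ImplicitComplexity.URel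
open Literature.Computability.ImplicitComplexity.STA (Deriv Ctx Term LinTy SoftTy encWord encBit tyS tyB tyF mpxRen
  liftRen)

/-! ## §B.3 Variables: one wrapped leaf, junk elsewhere -/

/-- The run description of a derivation of a variable `x_i` at a linear type with result `a`: slot `i` is present and
wrapped around `![a]`, every other slot is junk. [cite: LaurentTortoraDeFalco2006, Def. 12] -/
def VarSpec (Γ : Ctx) (i : ℕ) (ρ : Val) (a : Point) : Prop :=
  (∃ σ, Γ i = some σ) ∧ SlotIn (fun k => Wrap k (bang1 a)) Γ ρ i ∧ ∀ s, s ≠ i → SlotIn Junk Γ ρ s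

namespace VarSpec

variable {Γ : Ctx} {i : ℕ} {ρ : Val} {a : Point}

/-- `(w)` below a variable. [cite: LaurentTortoraDeFalco2006, Def. 12] -/
theorem weak (h : VarSpec Γ i ρ a) {j : ℕ} (hj : Γ j = none) (A : LinTy) :
    VarSpec (Function.update Γ j (some ⟨0, A⟩)) i (Function.update ρ j (some bang0)) a := by
  obtain ⟨⟨σ₀, hσ₀⟩, hW, hJ⟩ := h
  have hij : i ≠ j := fun hij => by rw [hij, hj] at hσ₀; cases hσ₀
  refine ⟨⟨σ₀, by rwa [Function.update_of_ne hij]⟩, hW.update_ne hij _ _, fun s hs => ?_⟩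
  by_cases hsj : s = j
  · subst hsj; exact SlotIn.update_self_junk s A
  · exact (hJ s hs).update_ne hsj _ _

/-- `(m)` below a variable: either the variable's slot is contracted (the fresh slot is wrapped one level up, the
other contracted slots being junk) or it is untouched (the fresh slot is junk). [cite: LaurentTortoraDeFalco2006, Def. 12] -/
theorem mpx (h : VarSpec Γ i ρ a) {S : Finset ℕ} {j : ℕ} {τ : SoftTy} (hS : ∀ s ∈ S, Γ s = some τ)
    (hj : Γ j = none) : VarSpec (Γ.mpx S j τ) (mpxRen S j i) (mpxVal S j ρ) a := by
  obtain ⟨⟨σ₀, hσ₀⟩, hW, hJ⟩ := h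
  have hjS : j ∉ S := fun hj' => by simpa [hj] using hS j hj'
  have hij : i ≠ j := fun e => by rw [e, hj] at hσ₀; cases hσ₀
  by_cases hiS : i ∈ S
  · have hi : mpxRen S j i = j := by simp [mpxRen, hiS]
    rw [hi]
    refine ⟨⟨τ.bang, by simp [Ctx.mpx, hjS]⟩, fun σ hσ' => ?_, fun s hs => ?_⟩
    · simp only [Ctx.mpx, hjS, if_false, if_true, Option.some.injEq] at hσ'
      subst hσ'
      refine ⟨Point.ofCourse (S.val.map ρ.label), by simp [mpxVal, hjS], ?_⟩
      show Point.ofCourse (S.val.map ρ.label) ∈ Wrap (τ.bangs + 1) (bang1 a)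
      obtain ⟨V, hV, hVm⟩ := hW _ (hS i hiS)
      refine ⟨V, hVm, (S.erase i).val.map ρ.label, fun y hy => ?_, ?_⟩
      · obtain ⟨s, hs, rfl⟩ := Multiset.mem_map.1 hy
        rw [Finset.mem_val, Finset.mem_erase] at hs
        obtain ⟨J, hJ', hJm⟩ := hJ s hs.1 _ (hS s hs.2)
        simpa [Val.label, hJ'] using hJm
      · rw [← Multiset.cons_erase (Finset.mem_def.1 hiS), Multiset.map_cons, Finset.erase_val]
        simp [Val.label, hV]
    · by_cases hsS : s ∈ S
      · exact SlotIn.mpx_of_mem hsS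
      · exact (hJ s (fun e => hsS (e ▸ hiS))).mpx_of_not_mem hsS hs
  · have hi : mpxRen S j i = i := by simp [mpxRen, hiS]
    rw [hi]
    refine ⟨⟨σ₀, by simp [Ctx.mpx, hiS, hij, hσ₀]⟩, hW.mpx_of_not_mem hiS hij, fun s hs => ?_⟩
    by_cases hsS : s ∈ S
    · exact SlotIn.mpx_of_mem hsS
    · by_cases hsj : s = j
      · subst hsj
        exact SlotIn.mpx_self boxable_junk hS hj fun s' hs' => hJ s' fun e => hiS (e ▸ hs')
      · exact (hJ s hs).mpx_of_not_mem hsS hsj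

/-- `(∀I)` below a variable. [folklore] -/
theorem of_shift (h : VarSpec Γ.shift i ρ a) : VarSpec Γ i ρ a := by
  obtain ⟨⟨σ₀, hσ₀⟩, hW, hJ⟩ := h
  simp only [Ctx.shift, Option.map_eq_some_iff] at hσ₀
  obtain ⟨σ₁, hσ₁, -⟩ := hσ₀
  exact ⟨⟨σ₁, hσ₁⟩, hW.of_shift, fun s hs => (hJ s hs).of_shift⟩

/-- Leaving a binder other than the variable's. [folklore] -/
theorem unshift {o : Option SoftTy} (h : VarSpec (Ctx.cons o Γ) (i + 1) ρ a) : VarSpec Γ i (Val.unshift ρ) a := by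
  obtain ⟨⟨σ₀, hσ₀⟩, hW, hJ⟩ := h
  exact ⟨⟨σ₀, hσ₀⟩, hW.unshift, fun s hs => (hJ (s + 1) (by omega)).unshift⟩

end VarSpec

/-- **Runs of a variable.** Every run of every derivation of `Γ ⊢ x_i : A` (`A` linear) with result `a` has slot `i`
wrapped around `![a]` and junk elsewhere — through any number of `(w)`, `(m)`, `(∀I)`, `(∀E)` below the axiom.
[cite: LaurentTortoraDeFalco2006, Def. 12] -/
theorem var_runs : {d : ℕ} → {Γ : Ctx} → {M : Term} → {σ : SoftTy} → (D : Deriv d Γ M σ) → {i : ℕ} →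
    M = .var i → σ.bangs = 0 → ∀ {ρ : Val} {a : Point}, (ρ, a) ∈ D.interp → VarSpec Γ i ρ a
  | _, _, _, _, .ax (Γ := Γ) (i := i₀) h, i, hM, _, ρ, a, hr => by
      cases hM
      obtain ⟨a', he⟩ := hr
      simp only [Prod.mk.injEq] at he
      obtain ⟨rfl, rfl⟩ := he
      refine ⟨⟨_, h.1⟩, fun σ hσ => ?_, fun s hs σ hσ => ?_⟩
      · rw [h.1] at hσ; cases hσ
        exact ⟨_, by simp [Val.single], rfl⟩
      · exact absurd (h.2 s hs) (by simp [hσ])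
  | _, _, _, _, .weak j A h hj hΓ', i, hM, hσ, ρ, a, hr => by
      obtain ⟨ρ', p, hm, he⟩ := hr
      have ih := var_runs h hM hσ hm
      simp only [Prod.mk.injEq] at he
      obtain ⟨rfl, rfl⟩ := he
      subst hΓ'
      exact ih.weak hj A
  | _, _, _, _, .lam _, _, hM, _, _, _, _ => by cases hM
  | _, _, _, _, .app _ _ _, _, hM, _, _, _, _ => by cases hM
  | _, _, _, _, .mpx S j h hS hj hΓ' hM', i, hM, hσ, ρ, a, hr => by
      rw [hM] at hM'
      obtain ⟨i', e, hi'⟩ := rename_eq_var hM'.symm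
      obtain ⟨ρ', p, hm, he⟩ := hr
      have ih := var_runs h e hσ hm
      simp only [Prod.mk.injEq] at he
      obtain ⟨rfl, rfl⟩ := he
      subst hΓ'
      rw [← hi']
      exact ih.mpx hS hj
  | _, _, _, _, .sp _ _, _, _, hσ, _, _, _ => by simp at hσ
  | _, _, _, _, .allI h hΔ, i, hM, _, ρ, a, hr => by
      have ih := var_runs h hM rfl hr
      rw [hΔ] at ih
      exact ih.of_shift
  | _, _, _, _, .allE _ h, _, hM, _, _, _, hr => var_runs h hM rfl hr
  | _, _, _, _, .sum _ _, _, hM, _, _, _, _ => by cases hM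

/-- **Existence of runs of a variable**: every point is a result. [cite: LaurentTortoraDeFalco2006, Def. 12] -/
theorem var_exists : {d : ℕ} → {Γ : Ctx} → {M : Term} → {σ : SoftTy} → (D : Deriv d Γ M σ) → {i : ℕ} →
    M = .var i → σ.bangs = 0 → ∀ a : Point, ∃ ρ : Val, (ρ, a) ∈ D.interp
  | _, _, _, _, .ax _, _, hM, _, a => by cases hM; exact ⟨_, a, rfl⟩
  | _, _, _, _, .weak j A h hj hΓ', i, hM, hσ, a => by
      obtain ⟨ρ, hρ⟩ := var_exists h hM hσ a
      exact ⟨_, ρ, a, hρ, rfl⟩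
  | _, _, _, _, .lam _, _, hM, _, _ => by cases hM
  | _, _, _, _, .app _ _ _, _, hM, _, _ => by cases hM
  | _, _, _, _, .mpx S j h hS hj hΓ' hM', i, hM, hσ, a => by
      rw [hM] at hM'
      obtain ⟨i', e, -⟩ := rename_eq_var hM'.symm
      obtain ⟨ρ, hρ⟩ := var_exists h e hσ a
      exact ⟨_, ρ, a, hρ, rfl⟩
  | _, _, _, _, .sp _ _, _, _, hσ, _ => by simp at hσ
  | _, _, _, _, .allI h _, _, hM, _, a => var_exists h hM rfl a
  | _, _, _, _, .allE _ h, _, hM, _, a => var_exists h hM rfl a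
  | _, _, _, _, .sum _ _, _, hM, _, _ => by cases hM

/-- A derivation of a variable has the variable in its context. [cite: GaboardiMarionRonchidellarocca2008, Table 2] -/
theorem var_present {d : ℕ} {Γ : Ctx} {M : Term} {σ : SoftTy} (D : Deriv d Γ M σ) {i : ℕ} (hM : M = .var i)
    (hσ : σ.bangs = 0) : ∃ τ, Γ i = some τ := by
  obtain ⟨ρ, hρ⟩ := var_exists D hM hσ Point.one
  exact (var_runs D hM hσ hρ).1

/-! ## §B.4 Type shapes: leading quantifiers, bang counts of head arrows, the quantifier tower of a variable -/

/-- Strip the leading quantifiers of a linear type. [folklore] -/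
def peel : LinTy → LinTy
  | .all A => peel A
  | .tvar n => .tvar n
  | .limp k B C => .limp k B C

/-- `peel` goes under a quantifier. [folklore] -/
@[simp] theorem peel_all (A : LinTy) : peel (.all A) = peel A := rfl
/-- A type variable is peeled. [folklore] -/
@[simp] theorem peel_tvar (n : ℕ) : peel (.tvar n) = .tvar n := rfl
/-- An arrow is peeled. [folklore] -/
@[simp] theorem peel_limp (k : ℕ) (B C : LinTy) : peel (.limp k B C) = .limp k B C := rfl

/-- Substitution goes through the leading quantifiers and keeps a head arrow with its bang count. [folklore] -/
theorem peel_substp_limp {A : LinTy} {k : ℕ} {B C : LinTy} (h : peel A = .limp k B C) (τ : ℕ → LinTy) :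
    ∃ τ', peel (A.substp τ) = .limp k (B.substp τ') (C.substp τ') := by
  induction A generalizing τ with
  | tvar n => simp at h
  | limp k' B' C' _ _ =>
    simp only [peel_limp, LinTy.limp.injEq] at h
    obtain ⟨rfl, rfl, rfl⟩ := h
    exact ⟨τ, rfl⟩
  | all A ih => exact ih h _

/-- `ArrLike A`: if the head of `A` (under its leading quantifiers) is an arrow, its argument is LINEAR (`k = 0`).
[folklore] -/
def ArrLike (A : LinTy) : Prop := ∀ k B C, peel A = .limp k B C → k = 0

/-- `BoolLike A`: the head arrow (if any) is linear and so is the head arrow of its codomain — the shape of the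
Boolean type `B = ∀α. α ⊸ α ⊸ α` and of all its anti-instances. [folklore] -/
def BoolLike (A : LinTy) : Prop := ∀ k B C, peel A = .limp k B C → k = 0 ∧ ArrLike C

/-- `ArrLike` descends along a substitution. [folklore] -/
theorem ArrLike.of_substp {A : LinTy} {τ : ℕ → LinTy} (h : ArrLike (A.substp τ)) : ArrLike A := fun k _ _ hp => by
  obtain ⟨τ', h'⟩ := peel_substp_limp hp τ
  exact h k _ _ h'

/-- `BoolLike` descends along a substitution. [folklore] -/
theorem BoolLike.of_substp {A : LinTy} {τ : ℕ → LinTy} (h : BoolLike (A.substp τ)) : BoolLike A := fun k _ _ hp => by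
  obtain ⟨τ', h'⟩ := peel_substp_limp hp τ
  obtain ⟨hk, hC⟩ := h k _ _ h'
  exact ⟨hk, hC.of_substp⟩

/-- The Boolean type is `BoolLike`. [cite: GaboardiMarionRonchidellarocca2008, §3.2] -/
theorem boolLike_tyB : BoolLike tyB := by
  intro k B C h
  simp [STA.tyB] at h
  obtain ⟨rfl, -, rfl⟩ := h
  exact ⟨rfl, fun k' _ _ h' => by simp at h'; exact h'.1.symm⟩

/-- `∀ʲ A`. [folklore] -/
def allN : ℕ → LinTy → LinTy
  | 0, A => A
  | j + 1, A => .all (allN j A)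

/-- Lifting a substitution `j` times: above `j` it is the original substitution, renamed. [folklore] -/
theorem up_iterate_add (τ : ℕ → LinTy) : ∀ (j n : ℕ), (LinTy.up^[j] τ) (n + j) = (τ n).rename (· + j)
  | 0, n => (STA.LinTy.rename_id (τ n)).symm
  | j + 1, n => by
      rw [Function.iterate_succ', Function.comp_apply]
      show ((LinTy.up^[j] τ) (n + j)).rename Nat.succ = _
      rw [up_iterate_add τ j n, STA.LinTy.rename_rename]
      rfl

/-- Substitution under `∀ʲ`. [folklore] -/
theorem substp_allN (A : LinTy) : ∀ (j : ℕ) (τ : ℕ → LinTy), (allN j A).substp τ = allN j (A.substp (LinTy.up^[j] τ))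
  | 0, _ => rfl
  | j + 1, τ => by
      show LinTy.all ((allN j A).substp (LinTy.up τ)) = LinTy.all _
      rw [substp_allN A j, ← Function.iterate_succ_apply]

/-- Opening the outermost quantifier of the tower `∀ʲ⁺¹ K⁺⁽ʲ⁺¹⁾` gives the tower `∀ʲ K⁺ʲ`, whatever the instance
(the bound variable does not occur). [folklore] -/
theorem inst_allN_rename (K A' : LinTy) (j : ℕ) :
    (allN j (K.rename (· + (j + 1)))).inst A' = allN j (K.rename (· + j)) := by
  unfold LinTy.inst
  rw [substp_allN, STA.LinTy.substp_rename, STA.LinTy.rename_eq_substp K (· + j)]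
  congr 1
  congr 1
  funext n
  show (LinTy.up^[j] _) (n + (j + 1)) = LinTy.tvar (n + j)
  rw [show n + (j + 1) = (n + 1) + j by omega, up_iterate_add]
  rfl

/-- A peeled type is not a quantification. [folklore] -/
theorem peel_ne_all : ∀ (A B : LinTy), peel A ≠ .all B
  | .tvar _, _, h => by cases h
  | .limp _ _ _, _, h => by cases h
  | .all A, B, h => peel_ne_all A B h

/-- A renamed non-quantified type is non-quantified. [folklore] -/
theorem peel_rename_of_peel_eq {K : LinTy} (h : peel K = K) (f : ℕ → ℕ) : peel (K.rename f) = K.rename f := by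
  cases K with
  | tvar _ => rfl
  | limp _ _ _ => rfl
  | all A => exact absurd h (peel_ne_all _ _)

/-- `∀ B` is not a tower of height `0` over a non-quantified type. [folklore] -/
theorem allN_eq_all {K : LinTy} (hK : peel K = K) {f : ℕ → ℕ} {B : LinTy} :
    ∀ {j : ℕ}, LinTy.all B = allN j (K.rename f) → ∃ j', j = j' + 1 ∧ B = allN j' (K.rename f)
  | 0, h => by
      change LinTy.all B = K.rename f at h
      cases K with
      | tvar _ => cases h
      | limp _ _ _ => cases h
      | all A => exact absurd hK (peel_ne_all _ _)
  | j + 1, h => ⟨j, rfl, by simpa [allN] using h⟩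

/-- **The quantifier tower of a variable.** The type of any derivation of `Γ ⊢ x_i : T` (`T` linear) from a
non-quantified context kernel `K` is `∀ʲ K⁺ʲ`: the `(∀I)`/`(∀E)` below the axiom only wrap vacuous quantifiers and
remove them again (a quantifier can bind no variable of `K`, which sits in the context).
[cite: GaboardiMarionRonchidellarocca2008, Table 2] -/
theorem var_ty : {d : ℕ} → {Γ : Ctx} → {M : Term} → {σ : SoftTy} → (D : Deriv d Γ M σ) → {i k : ℕ} → {K : LinTy} →
    M = .var i → σ.bangs = 0 → Γ i = some ⟨k, K⟩ → peel K = K → ∃ j, σ.lin = allN j (K.rename (· + j))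
  | _, _, _, _, .ax h, i, k, K, hM, _, hΓ, _ => by
      cases hM
      rw [h.1] at hΓ; cases hΓ
      exact ⟨0, (STA.LinTy.rename_id _).symm⟩
  | _, _, _, _, .weak j A h hj hΓ', i, k, K, hM, hσ, hΓ, hK => by
      obtain ⟨τ, hτ⟩ := var_present h hM hσ
      have hij : i ≠ j := fun e => by rw [e, hj] at hτ; cases hτ
      rw [hΓ', Function.update_of_ne hij] at hΓ
      exact var_ty h hM hσ hΓ hK
  | _, _, _, _, .lam _, _, _, _, hM, _, _, _ => by cases hM
  | _, _, _, _, .app _ _ _, _, _, _, hM, _, _, _ => by cases hM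
  | _, _, _, _, .mpx (Γ := Γ) (σ := τ) S j h hS hj hΓ' hM', i, k, K, hM, hσ, hΓ, hK => by
      rw [hM] at hM'
      obtain ⟨i', e, hi'⟩ := rename_eq_var hM'.symm
      obtain ⟨τ₀, hτ₀⟩ := var_present h e hσ
      have hjS : j ∉ S := fun hj' => by simpa [hj] using hS j hj'
      have hij : i' ≠ j := fun e => by rw [e, hj] at hτ₀; cases hτ₀
      by_cases hiS : i' ∈ S
      · have hi : i = j := by rw [← hi']; simp [mpxRen, hiS]
        subst hi
        rw [hΓ'] at hΓ
        simp only [Ctx.mpx, hjS, if_false, if_true, Option.some.injEq] at hΓ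
        have hτK : τ.lin = K := congrArg SoftTy.lin hΓ
        exact var_ty h e hσ (k := τ.bangs) (by rw [hS i' hiS, ← hτK]) hK
      · have hi : i = i' := by rw [← hi']; simp [mpxRen, hiS]
        subst hi
        rw [hΓ'] at hΓ
        simp only [Ctx.mpx, hiS, if_false, hij] at hΓ
        exact var_ty h e hσ hΓ hK
  | _, _, _, _, .sp _ _, _, _, _, _, hσ, _, _ => by simp at hσ
  | _, _, _, _, .allI (Γ := Γ) (A := A) h hΔ, i, k, K, hM, _, hΓ, hK => by
      have hΔi : Γ.shift i = some ⟨k, K.rename Nat.succ⟩ := by simp [Ctx.shift, hΓ]; rfl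
      rw [← hΔ] at hΔi
      obtain ⟨j, hj⟩ := var_ty h hM rfl hΔi (peel_rename_of_peel_eq hK _)
      refine ⟨j + 1, ?_⟩
      change A = _ at hj
      change LinTy.all A = LinTy.all _
      have hf : ((fun x => x + j) ∘ Nat.succ) = (fun x => x + (j + 1)) := by
        funext x; show x.succ + j = x + (j + 1); omega
      rw [hj, STA.LinTy.rename_rename, hf]
  | _, _, _, _, .allE A' h, i, k, K, hM, _, hΓ, hK => by
      obtain ⟨j, hj⟩ := var_ty h hM rfl hΓ hK
      obtain ⟨j', rfl, hB⟩ := allN_eq_all hK hj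
      refine ⟨j', ?_⟩
      show LinTy.inst _ A' = _
      rw [hB, inst_allN_rename]
  | _, _, _, _, .sum _ _, _, _, _, hM, _, _, _ => by cases hM

/-- `liftRen f` vanishes only at `0`. [folklore] -/
theorem liftRen_eq_zero {f : ℕ → ℕ} {i : ℕ} (h : liftRen f i = 0) : i = 0 := by
  rcases i with _ | i'
  · rfl
  · simp [liftRen] at h

/-- `liftRen f` takes a successor value only at a successor. [folklore] -/
theorem liftRen_eq_succ {f : ℕ → ℕ} {i n : ℕ} (h : liftRen f i = n + 1) : ∃ i', i = i' + 1 ∧ f i' = n := by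
  rcases i with _ | i'
  · simp [liftRen] at h
  · exact ⟨i', rfl, by simpa [liftRen] using h⟩

/-- Renaming goes through the leading quantifiers. [folklore] -/
theorem peel_rename (A : LinTy) (f : ℕ → ℕ) : ∃ f', peel (A.rename f) = (peel A).rename f' := by
  induction A generalizing f with
  | tvar n => exact ⟨f, rfl⟩
  | limp k B C _ _ => exact ⟨f, rfl⟩
  | all A ih => exact ih (liftRen f)

/-- `ArrLike` is invariant under renaming. [folklore] -/
theorem ArrLike.rename {A : LinTy} (h : ArrLike A) (f : ℕ → ℕ) : ArrLike (A.rename f) := by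
  intro k B C hp
  obtain ⟨f', hf'⟩ := peel_rename A f
  rw [hf'] at hp
  revert hp
  cases hA : peel A with
  | tvar _ => intro hp; cases hp
  | all _ => intro hp; cases hp
  | limp k₀ B₀ C₀ => intro hp; cases hp; exact h _ _ _ hA

/-- `BoolLike` is invariant under renaming. [folklore] -/
theorem BoolLike.rename {A : LinTy} (h : BoolLike A) (f : ℕ → ℕ) : BoolLike (A.rename f) := by
  intro k B C hp
  obtain ⟨f', hf'⟩ := peel_rename A f
  rw [hf'] at hp
  revert hp
  cases hA : peel A with
  | tvar _ => intro hp; cases hp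
  | all _ => intro hp; cases hp
  | limp k₀ B₀ C₀ =>
    intro hp; cases hp
    obtain ⟨hk, hC⟩ := h _ _ _ hA
    exact ⟨hk, hC.rename _⟩

end Summit.PneNP.PneNP.Theorems.OracleRefusal.Negative
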